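import Summits.CriticalPhenomena.PercolationContinuityZ3.Theorems.PercNearOneGluingNoHeavyLowerTailThreePointProductFormBoxDisc
import Summits.CriticalPhenomena.PercolationContinuityZ3.Theorems.PercNearOneGluingNoHeavyLowerTailThreePointProductFormModuleCone

/-!
# The box theorem: two ε-laws on reachable states (outer laws for architecture III)

Support file (`--supports stmt-CriticalPhenomena-4575`).  Standard axioms, no sorries, no named facts.  Memo
`run/shared/lean/prim/prim-sahi/FROM-prim-sahi-p2-gen73-OUTER-CONES.md` §0(3)(b), `prim-sahi-p2/PROOF-E3.md` §83.

In the outer-cone reduction (`boxval_nonneg_of_outerLaws` of `…OuterCones`) the outer cone must pin the `ε = E4`-coordinate of a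
reachable state against its `t`-coordinate and its invisible mass `a := ℓ(−m₊)`, `ℓ = (1, 23/8, 0)` (otherwise the pure-`ε` fake pair
pairs to `−12`).  This file proves, for every physical word:
* `t_le_eps`:  `t ≤ (8/3)·ε`  (LAW (T): `t = (8/3)·∏(3s²+d²)/4 ≤ (8/3)·∏ s² = (8/3)ε` since `d² ≤ s²`);
* `eps_sq_le`: `ε² ≤ 16·t·ℓ(−m₊)` for every NONEMPTY physical word (LAW (E2)); the constant `16` is sharp (depth 1, `d = 0`).
The induction for (E2) uses the cone law `m₊ ∈ −K` (`colP_negK` of `…ModuleCone`) through the growth inequality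
`ℓ(M(s,d)k) ≥ (4/3)s²·ℓ(k)` for `k ∈ K` (`ellP_step_ge`: the defect is a nonnegative combination of `(s+d)²`, `(s−d)²`, `(s+d)(s−d)`
times the `K`-coordinates), and the nonnegativity of the `ℓ`-readout of the `m₊`-source, `(3/256)s² + (3/1600)d²`.
[this work] (gen 73).
-/

namespace Summit.CriticalPhenomena.PercolationContinuityZ3.Theorems.ProductFormABPlus

open ProductFormModuleCone (c1 c2 c3 negK colP_negK cols_negK)

/-! ### 1. The `ℓ`-readout of the invisible column -/

/-- `ℓ(−m₊)` in the `K`-coordinates of `m₊`: `ℓ(−m₊) = −(3c₁ + 3c₂ + (5/2)c₃)(m₊)`. [this work] -/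
theorem ellP_eq_K (v : StA) : -((colP v).x + (23/8) * (colP v).y) = -(3 * c1 (colP v) + 3 * c2 (colP v) + (5/2) * c3 (colP v)) := by
  simp only [c1, c2, c3]; ring

/-- `ℓ(−m₊) ≥ 0` whenever `m₊ ∈ −K`. [this work] -/
theorem ellP_nonneg_of_negK {v : StA} (h : negK (colP v)) : 0 ≤ -((colP v).x + (23/8) * (colP v).y) := by
  rw [ellP_eq_K]; obtain ⟨h1, h2, h3⟩ := h; linarith

/-- `ℓ(−m₊) ≥ 0` along every physical word. [this work] -/
theorem ellP_nonneg (w : List (ℚ × ℚ)) (hw : ∀ θ ∈ w, 0 ≤ θ.1 + θ.2 ∧ 0 ≤ θ.1 - θ.2) :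
    0 ≤ -((colP (brunA w omegaA)).x + (23/8) * (colP (brunA w omegaA)).y) :=
  ellP_nonneg_of_negK (colP_negK w hw)

/-- ONE-STEP IDENTITY for `ℓ(−m₊)`: growth `(4/3)s²`, a defect that is a combination of `(s+d)², (s−d)², (s+d)(s−d)` times the
`K`-coordinates of `−m₊`, and the source `t·((3/256)s² + (3/1600)d²)`. [this work] -/
theorem ellP_bstepA (s d : ℚ) (v : StA) :
    -((colP (bstepA s d v)).x + (23/8) * (colP (bstepA s d v)).y) = (4/3) * s ^ 2 * -((colP v).x + (23/8) * (colP v).y)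
      + ((s + d) ^ 2 * (71/32) + (s - d) ^ 2 * (39/32) + (s + d) * (s - d) * (19/16)) * (-c1 (colP v))
      + ((s + d) ^ 2 * (39/32) + (s - d) ^ 2 * (71/32) + (s + d) * (s - d) * (19/16)) * (-c2 (colP v))
      + ((s + d) ^ 2 * (77/48) + (s - d) ^ 2 * (77/48) + (s + d) * (s - d) * (17/24)) * (-c3 (colP v))
      + v.t * ((3/256) * s ^ 2 + (3/1600) * d ^ 2) := by
  simp only [colP, bstepA, combA, stepA, c1, c2, c3]
  ring

/-- GROWTH LEMMA: for a physical letter, `t ≥ 0` and `m₊ ∈ −K`:  `ℓ(−m₊(N_θ v)) ≥ (4/3)s²·ℓ(−m₊(v))`. [this work] -/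
theorem ellP_step_ge (s d : ℚ) (v : StA) (hp : 0 ≤ s + d) (hm : 0 ≤ s - d) (ht : 0 ≤ v.t) (hK : negK (colP v)) :
    (4/3) * s ^ 2 * -((colP v).x + (23/8) * (colP v).y) ≤ -((colP (bstepA s d v)).x + (23/8) * (colP (bstepA s d v)).y) := by
  rw [ellP_bstepA]
  obtain ⟨h1, h2, h3⟩ := hK
  have hP : 0 ≤ (s + d) * (s - d) := mul_nonneg hp hm
  have hA : 0 ≤ (s + d) ^ 2 := sq_nonneg _
  have hB : 0 ≤ (s - d) ^ 2 := sq_nonneg _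
  have g1 : 0 ≤ (s + d) ^ 2 * (71/32) + (s - d) ^ 2 * (39/32) + (s + d) * (s - d) * (19/16) := by linarith
  have g2 : 0 ≤ (s + d) ^ 2 * (39/32) + (s - d) ^ 2 * (71/32) + (s + d) * (s - d) * (19/16) := by linarith
  have g3 : 0 ≤ (s + d) ^ 2 * (77/48) + (s - d) ^ 2 * (77/48) + (s + d) * (s - d) * (17/24) := by linarith
  have e1 : 0 ≤ ((s + d) ^ 2 * (71/32) + (s - d) ^ 2 * (39/32) + (s + d) * (s - d) * (19/16)) * (-c1 (colP v)) :=
    mul_nonneg g1 (by linarith)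
  have e2 : 0 ≤ ((s + d) ^ 2 * (39/32) + (s - d) ^ 2 * (71/32) + (s + d) * (s - d) * (19/16)) * (-c2 (colP v)) :=
    mul_nonneg g2 (by linarith)
  have e3 : 0 ≤ ((s + d) ^ 2 * (77/48) + (s - d) ^ 2 * (77/48) + (s + d) * (s - d) * (17/24)) * (-c3 (colP v)) :=
    mul_nonneg g3 (by linarith)
  have e4 : 0 ≤ v.t * ((3/256) * s ^ 2 + (3/1600) * d ^ 2) := mul_nonneg ht (by positivity)
  linarith

/-! ### 2. The `ε`-coordinate -/

/-- `ε` is multiplied by `s²` by a letter `(s,d)`. [this work] -/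
theorem E4_bstepB (s d : ℚ) (v : StB) : (bstepB s d v).E4 = s ^ 2 * v.E4 := by
  simp [bstepB, combB, stepB]

/-! ### 3. LAW (T): `t ≤ (8/3)·ε` -/

/-- ★ LAW (T): along every physical word, `t ≤ (8/3)·ε` (equality for hub/corner words). [this work] -/
theorem t_le_eps (w : List (ℚ × ℚ)) (hw : ∀ θ ∈ w, 0 ≤ θ.1 + θ.2 ∧ 0 ≤ θ.1 - θ.2) :
    (brunA w omegaA).t ≤ (8/3) * (brunB w omegaB).E4 := by
  induction w with
  | nil => norm_num [brunA, brunB, omegaA, omegaB]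
  | cons θ w ih =>
    have hθ := hw θ (by simp)
    have hw' : ∀ θ' ∈ w, 0 ≤ θ'.1 + θ'.2 ∧ 0 ≤ θ'.1 - θ'.2 := fun θ' h => hw θ' (by simp [h])
    have ih' := ih hw'
    have ht : 0 ≤ (brunA w omegaA).t := (cols_negK w hw').1
    have hE : 0 ≤ (brunB w omegaB).E4 := E4_brunB_nonneg w
    show (bstepA θ.1 θ.2 (brunA w omegaA)).t ≤ (8/3) * (bstepB θ.1 θ.2 (brunB w omegaB)).E4
    rw [ProductFormModuleCone.t_bstepA, E4_bstepB]
    have hdd : θ.2 ^ 2 ≤ θ.1 ^ 2 := by nlinarith [mul_nonneg hθ.1 hθ.2]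
    nlinarith [mul_nonneg ht (sub_nonneg.mpr hdd), mul_nonneg (sq_nonneg θ.1) (sub_nonneg.mpr ih')]

/-! ### 4. LAW (E2): `ε² ≤ 16·t·ℓ(−m₊)` -/

/-- ★ LAW (E2): for every NONEMPTY physical word, `ε² ≤ 16·t·ℓ(−m₊)`; sharp at depth 1, `d = 0`
(`ε = s²`, `t = 2s²`, `ℓ(−m₊) = s²/32`). [this work] -/
theorem eps_sq_le (w : List (ℚ × ℚ)) (hw : ∀ θ ∈ w, 0 ≤ θ.1 + θ.2 ∧ 0 ≤ θ.1 - θ.2) (hne : w ≠ []) :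
    (brunB w omegaB).E4 ^ 2 ≤ 16 * (brunA w omegaA).t * -((colP (brunA w omegaA)).x + (23/8) * (colP (brunA w omegaA)).y) := by
  induction w with
  | nil => exact absurd rfl hne
  | cons θ w ih =>
    have hθ := hw θ (by simp)
    have hw' : ∀ θ' ∈ w, 0 ≤ θ'.1 + θ'.2 ∧ 0 ≤ θ'.1 - θ'.2 := fun θ' h => hw θ' (by simp [h])
    have ht : 0 ≤ (brunA w omegaA).t := (cols_negK w hw').1
    have hK : negK (colP (brunA w omegaA)) := colP_negK w hw'
    have hl : 0 ≤ -((colP (brunA w omegaA)).x + (23/8) * (colP (brunA w omegaA)).y) := ellP_nonneg_of_negK hK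
    have hgrow := ellP_step_ge θ.1 θ.2 (brunA w omegaA) hθ.1 hθ.2 ht hK
    have hP : 0 ≤ (θ.1 + θ.2) * (θ.1 - θ.2) := mul_nonneg hθ.1 hθ.2
    show (bstepB θ.1 θ.2 (brunB w omegaB)).E4 ^ 2 ≤
      16 * (bstepA θ.1 θ.2 (brunA w omegaA)).t * -((colP (bstepA θ.1 θ.2 (brunA w omegaA))).x + (23/8) * (colP (bstepA θ.1 θ.2 (brunA w omegaA))).y)
    rw [ProductFormModuleCone.t_bstepA, E4_bstepB]
    by_cases hnil : w = []
    · -- base case: depth 1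
      subst hnil
      have e0 : -((colP (bstepA θ.1 θ.2 (brunA [] omegaA))).x + (23/8) * (colP (bstepA θ.1 θ.2 (brunA [] omegaA))).y) = (8/3) * ((3/256) * θ.1 ^ 2 + (3/1600) * θ.2 ^ 2) := by
        simp only [brunA]
        rw [ellP_bstepA]
        simp only [colP, omegaA, c1, c2, c3]
        ring
      rw [e0]
      simp only [brunA, brunB, omegaA, omegaB]
      nlinarith [sq_nonneg θ.1, sq_nonneg θ.2, mul_nonneg (sq_nonneg θ.1) (sq_nonneg θ.2),
        mul_nonneg (sq_nonneg θ.2) (sq_nonneg θ.2), mul_nonneg (sq_nonneg θ.1) (sq_nonneg θ.1)]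
    · -- inductive case
      have ih' := ih hw' hnil
      set T := (brunA w omegaA).t with hT
      set L := -((colP (brunA w omegaA)).x + (23/8) * (colP (brunA w omegaA)).y) with hL
      set E := (brunB w omegaB).E4 with hE
      set L' := -((colP (bstepA θ.1 θ.2 (brunA w omegaA))).x + (23/8) * (colP (bstepA θ.1 θ.2 (brunA w omegaA))).y) with hL'
      -- E'² = s⁴E² ≤ s⁴·16·T·L = 16·((3/4)s²T)·((4/3)s²L) ≤ 16·T'·L'
      have h1 : (θ.1 ^ 2 * E) ^ 2 ≤ θ.1 ^ 4 * (16 * T * L) := by nlinarith [sq_nonneg (θ.1 ^ 2)]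
      have hTL : 0 ≤ T * L := mul_nonneg ht hl
      have h2 : (3/4) * θ.1 ^ 2 * T ≤ ((3 * θ.1 ^ 2 + θ.2 ^ 2) / 4) * T := by nlinarith [sq_nonneg θ.2]
      have h3 : 0 ≤ ((3 * θ.1 ^ 2 + θ.2 ^ 2) / 4) * T := mul_nonneg (by positivity) ht
      have hL'0 : 0 ≤ L' := le_trans (by positivity) hgrow
      have h4 : ((3/4) * θ.1 ^ 2 * T) * ((4/3) * θ.1 ^ 2 * L) ≤ (((3 * θ.1 ^ 2 + θ.2 ^ 2) / 4) * T) * L' :=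
        mul_le_mul h2 hgrow (by positivity) h3
      nlinarith [h1, h4]

end Summit.CriticalPhenomena.PercolationContinuityZ3.Theorems.ProductFormABPlus
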